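import Mathlib
import Summits.ValiantsHypothesis.ValiantsHypothesis.Theorems.KPlusLogSqLawLiftingLaguerreWindowSteps

/-!
# Two-sided Descartes–Laguerre rule on an interval, part 4: the theorem

HONEST FRAMING.  Helper file toward the lifting crux `WeakLifting` (stmt-ValiantsHypothesis-19561; aside `Lifting`
stmt-ValiantsHypothesis-19772, registered stub `stub_liftThin`) of route `KPlusLogSqLaw` (cell `pub-symmetroid`, seat
val-sym-lift-p1 g8, 2026-08-27).  Elementary real analysis about ONE real function on an interval `(a, b)`, `0 < a < b`; nothing
here asserts `WeakLifting`, `TropicalB`, Conjecture B, `MatrixDescartes` (stmt-ValiantsHypothesis-18050) or anything about VP ≠ VNP.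

THEOREM (`card_le_signVar_window`): for `F = σ_L·L + Σ_k g_k x^k + σ_H·H` on `(a,b)` (`0 < a < b`; admissible low / high tails,
window exponents strictly increasing in `(e, N)`, `e + 1 < N`; `F ≢ 0`) every finite set of zeros of `F` in `(a,b)` has at most
`Var(σ_L·L(c), g_1, …, g_r, σ_H·H(c))` elements (`c = (a+b)/2`, the Literature's `signVar`).  Descartes' induction on the number of
window terms: Euler step at a head sign change (`…_euler`), absorption otherwise (`…_absorb`), IH-free cases in part 3.  USE: the
two-point Laguerre rule for polynomials (`f/((x−a)(b−x))` has this shape) and the LOCAL DESCARTES RULE between two archimedean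
dominance points (GAP-LIFT §4 (S-loc), val-sym-lift-p4).  No `def`.
[folklore] (Laguerre's method, cf. [VanMieghem2010, art. 317, Thm 88] for the one-point rule).
-/

set_option linter.dupNamespace false
set_option autoImplicit false

namespace Summit.ValiantsHypothesis.ValiantsHypothesis.Theorems.KPlusLogSqLaw.LocalDescartes

open Set Finset
open scoped BigOperators
open Literature.Algebra.Polynomial (signVar signVarAux)
open Literature.Computability.AlgebraicComplexity.BD17 (signVar_cons_cons_of_ne_zero)

/-- **Step, sign change at the head** (`σ_L·L(c)·g < 0`): one Euler step at `k`, then the induction hypothesis. [folklore] -/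
theorem card_le_signVar_window_euler (a b : ℝ) (ha : 0 < a) (hab : a < b)
    (e N : ℤ) (σL σH : ℝ) (L H : List (ℝ × ℤ × ℤ)) (k : ℤ) (g : ℝ) (W₀ : List (ℤ × ℝ))
    (heN : e + 1 < N)
    (hL : ∀ t ∈ L, 0 ≤ t.1 ∧ t.2.1 + t.2.2 ≤ e ∧ t.2.2 ≤ 0) (hH : ∀ t ∈ H, 0 ≤ t.1 ∧ N ≤ t.2.1 ∧ t.2.2 ≤ 0)
    (hkb : e < k ∧ k < N) (hkW₀ : ∀ q' ∈ W₀, k < q'.1) (hW₀pw : (W₀).Pairwise (fun p q => p.1 < q.1))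
    (hW₀bd : ∀ q' ∈ W₀, e < q'.1 ∧ q'.1 < N) (Z : Finset ℝ)
    (hZ : ∀ z ∈ Z, z ∈ Ioo a b ∧
      σL * (L.map (fun t : ℝ × ℤ × ℤ => t.1 * (z ^ t.2.1 * (z - a) ^ t.2.2))).sum
        + (((k, g) :: W₀).map (fun p : ℤ × ℝ => p.2 * z ^ p.1)).sum
        + σH * (H.map (fun t : ℝ × ℤ × ℤ => t.1 * (z ^ t.2.1 * (b - z) ^ t.2.2))).sum = 0)
    (hwit : ∃ x ∈ Ioo a b,
      σL * (L.map (fun t : ℝ × ℤ × ℤ => t.1 * (x ^ t.2.1 * (x - a) ^ t.2.2))).sum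
        + (((k, g) :: W₀).map (fun p : ℤ × ℝ => p.2 * x ^ p.1)).sum
        + σH * (H.map (fun t : ℝ × ℤ × ℤ => t.1 * (x ^ t.2.1 * (b - x) ^ t.2.2))).sum ≠ 0)
    (ih : ∀ (e N : ℤ) (σL σH : ℝ) (L H : List (ℝ × ℤ × ℤ)) (W : List (ℤ × ℝ)),
      W.length = W₀.length → e + 1 < N →
      (∀ t ∈ L, 0 ≤ t.1 ∧ t.2.1 + t.2.2 ≤ e ∧ t.2.2 ≤ 0) →
      (∀ t ∈ H, 0 ≤ t.1 ∧ N ≤ t.2.1 ∧ t.2.2 ≤ 0) →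
      W.Pairwise (fun p q => p.1 < q.1) → (∀ p ∈ W, e < p.1 ∧ p.1 < N) →
      ∀ Z : Finset ℝ,
      (∀ z ∈ Z, z ∈ Ioo a b ∧
        σL * (L.map (fun t : ℝ × ℤ × ℤ => t.1 * (z ^ t.2.1 * (z - a) ^ t.2.2))).sum
          + (W.map (fun p : ℤ × ℝ => p.2 * z ^ p.1)).sum
          + σH * (H.map (fun t : ℝ × ℤ × ℤ => t.1 * (z ^ t.2.1 * (b - z) ^ t.2.2))).sum = 0) →
      (∃ x ∈ Ioo a b,
        σL * (L.map (fun t : ℝ × ℤ × ℤ => t.1 * (x ^ t.2.1 * (x - a) ^ t.2.2))).sum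
          + (W.map (fun p : ℤ × ℝ => p.2 * x ^ p.1)).sum
          + σH * (H.map (fun t : ℝ × ℤ × ℤ => t.1 * (x ^ t.2.1 * (b - x) ^ t.2.2))).sum ≠ 0) →
      Z.card ≤ signVar (σL * (L.map (fun t : ℝ × ℤ × ℤ =>
        t.1 * (((a + b) / 2) ^ t.2.1 * ((a + b) / 2 - a) ^ t.2.2))).sum
        :: (W.map Prod.snd ++ [σH * (H.map (fun t : ℝ × ℤ × ℤ =>
        t.1 * (((a + b) / 2) ^ t.2.1 * (b - (a + b) / 2) ^ t.2.2))).sum])))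
    (hAg : σL * (L.map (fun t : ℝ × ℤ × ℤ =>
        t.1 * (((a + b) / 2) ^ t.2.1 * ((a + b) / 2 - a) ^ t.2.2))).sum * g < 0) :
    Z.card ≤ signVar (σL * (L.map (fun t : ℝ × ℤ × ℤ =>
        t.1 * (((a + b) / 2) ^ t.2.1 * ((a + b) / 2 - a) ^ t.2.2))).sum
      :: g :: ((W₀).map Prod.snd ++ [σH * (H.map (fun t : ℝ × ℤ × ℤ =>
        t.1 * (((a + b) / 2) ^ t.2.1 * (b - (a + b) / 2) ^ t.2.2))).sum])) := by
  have hc : (a + b) / 2 ∈ Ioo a b := ⟨by linarith, by linarith⟩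
  have hc0 : 0 < (a + b) / 2 := by linarith
  have hLnn : ∀ t ∈ L, 0 ≤ t.1 := fun t ht => (hL t ht).1
  have hHnn : ∀ t ∈ H, 0 ≤ t.1 := fun t ht => (hH t ht).1
  set A := σL * (L.map (fun t : ℝ × ℤ × ℤ => t.1 * (((a + b) / 2) ^ t.2.1 * ((a + b) / 2 - a) ^ t.2.2))).sum
    with hA
  set C := σH * (H.map (fun t : ℝ × ℤ × ℤ => t.1 * (((a + b) / 2) ^ t.2.1 * (b - (a + b) / 2) ^ t.2.2))).sum
    with hC
  have hELpos : (∃ t ∈ L, 0 < t.1) → ∀ x, a < x → 0 < (L.map (fun t : ℝ × ℤ × ℤ =>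
      t.1 * (x ^ t.2.1 * (x - a) ^ t.2.2))).sum := fun hf x hx => (lowEval_pos_or_zero a L hLnn).1 hf x hx (ha.trans hx)
  have hELzero : (¬ ∃ t ∈ L, 0 < t.1) → ∀ x, (L.map (fun t : ℝ × ℤ × ℤ =>
      t.1 * (x ^ t.2.1 * (x - a) ^ t.2.2))).sum = 0 := (lowEval_pos_or_zero a L hLnn).2
  have hEHpos : (∃ t ∈ H, 0 < t.1) → ∀ x, a < x → x < b → 0 < (H.map (fun t : ℝ × ℤ × ℤ =>
      t.1 * (x ^ t.2.1 * (b - x) ^ t.2.2))).sum :=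
    fun hf x hx hxb => (highEval_pos_or_zero b H hHnn).1 hf x hxb (ha.trans hx)
  have hEHzero : (¬ ∃ t ∈ H, 0 < t.1) → ∀ x, (H.map (fun t : ℝ × ℤ × ℤ =>
      t.1 * (x ^ t.2.1 * (b - x) ^ t.2.2))).sum = 0 := (highEval_pos_or_zero b H hHnn).2
  have hA0 : A ≠ 0 := fun h => by rw [h, zero_mul] at hAg; exact lt_irrefl _ hAg
  have hg0 : g ≠ 0 := fun h => by rw [h, mul_zero] at hAg; exact lt_irrefl _ hAg
  have hσL : σL ≠ 0 := fun h => hA0 (by rw [hA, h, zero_mul])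
  have hflagL : ∃ t ∈ L, 0 < t.1 := by
    by_contra hno; exact hA0 (by rw [hA, hELzero hno, mul_zero])
  obtain ⟨L', H', hL'adm, hH'adm, hL'flag, hH'flag, hder⟩ :=
    euler_step a b ha e N σL σH L H hL hH k hkb.1 hkb.2 ((k, g) :: W₀)
  set W₀' : List (ℤ × ℝ) := W₀.map (fun q : ℤ × ℝ => (q.1, ((q.1 : ℝ) - k) * q.2)) with hW₀'
  have hder' : ∀ x ∈ Ioo a b, HasDerivAt
      (fun y : ℝ => y ^ (-k) * (σL * (L.map (fun t : ℝ × ℤ × ℤ => t.1 * (y ^ t.2.1 * (y - a) ^ t.2.2))).sum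
        + (((k, g) :: W₀).map (fun p : ℤ × ℝ => p.2 * y ^ p.1)).sum
        + σH * (H.map (fun t : ℝ × ℤ × ℤ => t.1 * (y ^ t.2.1 * (b - y) ^ t.2.2))).sum))
      (x ^ (-k - 1) * ((-σL) * (L'.map (fun t : ℝ × ℤ × ℤ => t.1 * (x ^ t.2.1 * (x - a) ^ t.2.2))).sum
        + (W₀'.map (fun p : ℤ × ℝ => p.2 * x ^ p.1)).sum
        + σH * (H'.map (fun t : ℝ × ℤ × ℤ => t.1 * (x ^ t.2.1 * (b - x) ^ t.2.2))).sum)) x := by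
    intro x hx
    refine (hder x hx).congr_deriv ?_
    simp only [List.map_cons, List.sum_cons, List.map_map, hW₀', sub_self, zero_mul, zero_add]
  obtain ⟨Z', hcard, hZ'⟩ := exists_finset_zeros_euler ha k hder' Z hZ
  by_cases hwit' : ∃ x ∈ Ioo a b,
      (-σL) * (L'.map (fun t : ℝ × ℤ × ℤ => t.1 * (x ^ t.2.1 * (x - a) ^ t.2.2))).sum
        + (W₀'.map (fun p : ℤ × ℝ => p.2 * x ^ p.1)).sum
        + σH * (H'.map (fun t : ℝ × ℤ × ℤ => t.1 * (x ^ t.2.1 * (b - x) ^ t.2.2))).sum ≠ 0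
  · have hW₀'pw : W₀'.Pairwise (fun p q => p.1 < q.1) := by
      rw [hW₀', List.pairwise_map]; exact hW₀pw
    have hW₀'bd : ∀ q ∈ W₀', e < q.1 ∧ q.1 < N := by
      intro q hq
      rw [hW₀', List.mem_map] at hq
      obtain ⟨q₀, hq₀, rfl⟩ := hq
      exact hW₀bd q₀ hq₀
    have hih := ih e N (-σL) σH L' H' W₀' (by simp [hW₀']) heN hL'adm hH'adm hW₀'pw hW₀'bd Z' hZ' hwit'
    -- compare the two sign lists
    have hEL'c := (lowEval_pos_or_zero a L' (fun t ht => (hL'adm t ht).1)).1 (hL'flag.mpr hflagL) _ hc.1 hc0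
    have hELc := hELpos hflagL _ hc.1
    have hhead : (0 < g ↔ 0 < (-σL) * (L'.map (fun t : ℝ × ℤ × ℤ =>
          t.1 * (((a + b) / 2) ^ t.2.1 * ((a + b) / 2 - a) ^ t.2.2))).sum) ∧
        (g < 0 ↔ (-σL) * (L'.map (fun t : ℝ × ℤ × ℤ =>
          t.1 * (((a + b) / 2) ^ t.2.1 * ((a + b) / 2 - a) ^ t.2.2))).sum < 0) := by
      rw [hA] at hAg
      rcases lt_or_gt_of_ne hσL with hs | hs
      · have hAneg : σL * (L.map (fun t : ℝ × ℤ × ℤ =>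
            t.1 * (((a + b) / 2) ^ t.2.1 * ((a + b) / 2 - a) ^ t.2.2))).sum < 0 := mul_neg_of_neg_of_pos hs hELc
        have hgpos : 0 < g := by
          by_contra hle; push Not at hle
          have := mul_nonneg_of_nonpos_of_nonpos hAneg.le hle
          linarith
        have h2 : 0 < (-σL) * (L'.map (fun t : ℝ × ℤ × ℤ =>
            t.1 * (((a + b) / 2) ^ t.2.1 * ((a + b) / 2 - a) ^ t.2.2))).sum := mul_pos (by linarith) hEL'c
        constructor
        · constructor <;> intro <;> linarith
        · constructor <;> intro <;> linarith
      · have hApos : 0 < σL * (L.map (fun t : ℝ × ℤ × ℤ =>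
            t.1 * (((a + b) / 2) ^ t.2.1 * ((a + b) / 2 - a) ^ t.2.2))).sum := mul_pos hs hELc
        have hgneg : g < 0 := by
          by_contra hle; push Not at hle
          have := mul_nonneg hApos.le hle
          linarith
        have h2 : (-σL) * (L'.map (fun t : ℝ × ℤ × ℤ =>
            t.1 * (((a + b) / 2) ^ t.2.1 * ((a + b) / 2 - a) ^ t.2.2))).sum < 0 :=
          mul_neg_of_neg_of_pos (by linarith) hEL'c
        constructor
        · constructor <;> intro <;> linarith
        · constructor <;> intro <;> linarith
    have htailC : (0 < C ↔ 0 < σH * (H'.map (fun t : ℝ × ℤ × ℤ =>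
          t.1 * (((a + b) / 2) ^ t.2.1 * (b - (a + b) / 2) ^ t.2.2))).sum) ∧
        (C < 0 ↔ σH * (H'.map (fun t : ℝ × ℤ × ℤ =>
          t.1 * (((a + b) / 2) ^ t.2.1 * (b - (a + b) / 2) ^ t.2.2))).sum < 0) := by
      by_cases hfH : ∃ t ∈ H, 0 < t.1
      · have h1 := hEHpos hfH _ hc.1 hc.2
        have h2 := (highEval_pos_or_zero b H' (fun t ht => (hH'adm t ht).1)).1 (hH'flag.mpr hfH) _ hc.2 hc0
        rw [hC]
        refine signRel_of_posMul (div_pos h1 h2) ?_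
        rw [div_mul_eq_mul_div, eq_div_iff h2.ne']
        ring
      · have h1 := hEHzero hfH ((a + b) / 2)
        have h2 := (highEval_pos_or_zero b H' (fun t ht => (hH'adm t ht).1)).2
          (fun hf => hfH (hH'flag.mp hf)) ((a + b) / 2)
        rw [hC, h1, h2]
        exact ⟨Iff.rfl, Iff.rfl⟩
    have hrel : List.Forall₂ (fun u v => (0 < u ↔ 0 < v) ∧ (u < 0 ↔ v < 0))
        (g :: (W₀.map Prod.snd ++ [C]))
        ((-σL) * (L'.map (fun t : ℝ × ℤ × ℤ =>
          t.1 * (((a + b) / 2) ^ t.2.1 * ((a + b) / 2 - a) ^ t.2.2))).sum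
          :: (W₀'.map Prod.snd ++ [σH * (H'.map (fun t : ℝ × ℤ × ℤ =>
            t.1 * (((a + b) / 2) ^ t.2.1 * (b - (a + b) / 2) ^ t.2.2))).sum])) :=
      List.Forall₂.cons hhead (List.rel_append (forall₂_window_rescale k W₀ hkW₀)
        (List.Forall₂.cons htailC List.Forall₂.nil))
    rw [signVar_cons_cons_of_ne_zero hA0 hg0, if_pos hAg, signVar_congr hrel]
    omega
  · push Not at hwit'
    obtain ⟨x₀, hx₀I, hx₀⟩ := hwit
    have hzf := ne_zero_of_euler_zero ha k hder' hwit' hx₀I hx₀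
    have hZe : Z = ∅ := by
      by_contra hne
      obtain ⟨z, hz⟩ := Finset.nonempty_iff_ne_empty.mpr hne
      exact hzf z (hZ z hz).1 (hZ z hz).2
    rw [hZe, Finset.card_empty]
    exact Nat.zero_le _

/-- **Step, no head sign change, ≥ 2 window terms**: `g x^k` is ABSORBED into the low tail (virtual bound `k`). [folklore] -/
theorem card_le_signVar_window_absorb (q : ℤ × ℝ) (W₁ : List (ℤ × ℝ)) (a b : ℝ) (ha : 0 < a) (hab : a < b)
    (e N : ℤ) (σL σH : ℝ) (L H : List (ℝ × ℤ × ℤ)) (k : ℤ) (g : ℝ) 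
    (_heN : e + 1 < N)
    (hL : ∀ t ∈ L, 0 ≤ t.1 ∧ t.2.1 + t.2.2 ≤ e ∧ t.2.2 ≤ 0) (hH : ∀ t ∈ H, 0 ≤ t.1 ∧ N ≤ t.2.1 ∧ t.2.2 ≤ 0)
    (hkb : e < k ∧ k < N) (hkW₀ : ∀ q' ∈ (q :: W₁), k < q'.1) (hW₀pw : ((q :: W₁)).Pairwise (fun p q => p.1 < q.1))
    (hW₀bd : ∀ q' ∈ (q :: W₁), e < q'.1 ∧ q'.1 < N) (Z : Finset ℝ)
    (hZ : ∀ z ∈ Z, z ∈ Ioo a b ∧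
      σL * (L.map (fun t : ℝ × ℤ × ℤ => t.1 * (z ^ t.2.1 * (z - a) ^ t.2.2))).sum
        + (((k, g) :: (q :: W₁)).map (fun p : ℤ × ℝ => p.2 * z ^ p.1)).sum
        + σH * (H.map (fun t : ℝ × ℤ × ℤ => t.1 * (z ^ t.2.1 * (b - z) ^ t.2.2))).sum = 0)
    (hwit : ∃ x ∈ Ioo a b,
      σL * (L.map (fun t : ℝ × ℤ × ℤ => t.1 * (x ^ t.2.1 * (x - a) ^ t.2.2))).sum
        + (((k, g) :: (q :: W₁)).map (fun p : ℤ × ℝ => p.2 * x ^ p.1)).sum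
        + σH * (H.map (fun t : ℝ × ℤ × ℤ => t.1 * (x ^ t.2.1 * (b - x) ^ t.2.2))).sum ≠ 0)
    (ih : ∀ (e N : ℤ) (σL σH : ℝ) (L H : List (ℝ × ℤ × ℤ)) (W : List (ℤ × ℝ)),
      W.length = (q :: W₁).length → e + 1 < N →
      (∀ t ∈ L, 0 ≤ t.1 ∧ t.2.1 + t.2.2 ≤ e ∧ t.2.2 ≤ 0) →
      (∀ t ∈ H, 0 ≤ t.1 ∧ N ≤ t.2.1 ∧ t.2.2 ≤ 0) →
      W.Pairwise (fun p q => p.1 < q.1) → (∀ p ∈ W, e < p.1 ∧ p.1 < N) →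
      ∀ Z : Finset ℝ,
      (∀ z ∈ Z, z ∈ Ioo a b ∧
        σL * (L.map (fun t : ℝ × ℤ × ℤ => t.1 * (z ^ t.2.1 * (z - a) ^ t.2.2))).sum
          + (W.map (fun p : ℤ × ℝ => p.2 * z ^ p.1)).sum
          + σH * (H.map (fun t : ℝ × ℤ × ℤ => t.1 * (z ^ t.2.1 * (b - z) ^ t.2.2))).sum = 0) →
      (∃ x ∈ Ioo a b,
        σL * (L.map (fun t : ℝ × ℤ × ℤ => t.1 * (x ^ t.2.1 * (x - a) ^ t.2.2))).sum
          + (W.map (fun p : ℤ × ℝ => p.2 * x ^ p.1)).sum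
          + σH * (H.map (fun t : ℝ × ℤ × ℤ => t.1 * (x ^ t.2.1 * (b - x) ^ t.2.2))).sum ≠ 0) →
      Z.card ≤ signVar (σL * (L.map (fun t : ℝ × ℤ × ℤ =>
        t.1 * (((a + b) / 2) ^ t.2.1 * ((a + b) / 2 - a) ^ t.2.2))).sum
        :: (W.map Prod.snd ++ [σH * (H.map (fun t : ℝ × ℤ × ℤ =>
        t.1 * (((a + b) / 2) ^ t.2.1 * (b - (a + b) / 2) ^ t.2.2))).sum])))
    (hAg : ¬ σL * (L.map (fun t : ℝ × ℤ × ℤ =>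
        t.1 * (((a + b) / 2) ^ t.2.1 * ((a + b) / 2 - a) ^ t.2.2))).sum * g < 0) :
    Z.card ≤ signVar (σL * (L.map (fun t : ℝ × ℤ × ℤ =>
        t.1 * (((a + b) / 2) ^ t.2.1 * ((a + b) / 2 - a) ^ t.2.2))).sum
      :: g :: (((q :: W₁)).map Prod.snd ++ [σH * (H.map (fun t : ℝ × ℤ × ℤ =>
        t.1 * (((a + b) / 2) ^ t.2.1 * (b - (a + b) / 2) ^ t.2.2))).sum])) := by
  have hc : (a + b) / 2 ∈ Ioo a b := ⟨by linarith, by linarith⟩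
  have hc0 : 0 < (a + b) / 2 := by linarith
  have hLnn : ∀ t ∈ L, 0 ≤ t.1 := fun t ht => (hL t ht).1
  have hHnn : ∀ t ∈ H, 0 ≤ t.1 := fun t ht => (hH t ht).1
  set A := σL * (L.map (fun t : ℝ × ℤ × ℤ => t.1 * (((a + b) / 2) ^ t.2.1 * ((a + b) / 2 - a) ^ t.2.2))).sum
    with hA
  set C := σH * (H.map (fun t : ℝ × ℤ × ℤ => t.1 * (((a + b) / 2) ^ t.2.1 * (b - (a + b) / 2) ^ t.2.2))).sum
    with hC
  have hELpos : (∃ t ∈ L, 0 < t.1) → ∀ x, a < x → 0 < (L.map (fun t : ℝ × ℤ × ℤ =>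
      t.1 * (x ^ t.2.1 * (x - a) ^ t.2.2))).sum := fun hf x hx => (lowEval_pos_or_zero a L hLnn).1 hf x hx (ha.trans hx)
  have hELzero : (¬ ∃ t ∈ L, 0 < t.1) → ∀ x, (L.map (fun t : ℝ × ℤ × ℤ =>
      t.1 * (x ^ t.2.1 * (x - a) ^ t.2.2))).sum = 0 := (lowEval_pos_or_zero a L hLnn).2
  have hEHpos : (∃ t ∈ H, 0 < t.1) → ∀ x, a < x → x < b → 0 < (H.map (fun t : ℝ × ℤ × ℤ =>
      t.1 * (x ^ t.2.1 * (b - x) ^ t.2.2))).sum :=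
    fun hf x hx hxb => (highEval_pos_or_zero b H hHnn).1 hf x hxb (ha.trans hx)
  have hEHzero : (¬ ∃ t ∈ H, 0 < t.1) → ∀ x, (H.map (fun t : ℝ × ℤ × ℤ =>
      t.1 * (x ^ t.2.1 * (b - x) ^ t.2.2))).sum = 0 := (highEval_pos_or_zero b H hHnn).2
  have hAg' : 0 ≤ A * g := not_lt.mp hAg
  have hW₀len : (q :: W₁).length = (q :: W₁).length := rfl
  ------------------------------------------------------------ ABSORB `g x^k` into the low tail
  have hkq : k < q.1 := hkW₀ q (by simp)
  have hqN : q.1 < N := (hW₀bd q (by simp)).2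
  have hk1N : k + 1 < N := by omega
  have hWbd' : ∀ q' ∈ q :: W₁, k < q'.1 ∧ q'.1 < N := fun q' hq' => ⟨hkW₀ q' hq', (hW₀bd q' hq').2⟩
  by_cases hA0 : A = 0
  · -- the old low part vanishes identically; the new one is `g · x^k`
    have hLz : ∀ y, a < y → σL * (L.map (fun t : ℝ × ℤ × ℤ => t.1 * (y ^ t.2.1 * (y - a) ^ t.2.2))).sum = 0 := by
      intro y hy
      rcases mul_eq_zero.mp (hA.symm.trans hA0) with h | h
      · rw [h, zero_mul]
      · have hno : ¬ ∃ t ∈ L, 0 < t.1 := fun hf => (hELpos hf _ hc.1).ne' h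
        rw [hELzero hno y, mul_zero]
    have hadm : ∀ t ∈ [((1 : ℝ), k, (0 : ℤ))], 0 ≤ t.1 ∧ t.2.1 + t.2.2 ≤ k ∧ t.2.2 ≤ 0 := by
      intro t ht; simp only [List.mem_singleton] at ht; subst ht; norm_num
    have hih := ih k N g σH [((1 : ℝ), k, (0 : ℤ))] H (q :: W₁) hW₀len hk1N hadm hH hW₀pw hWbd' Z
      (by
        intro z hz
        obtain ⟨hzI, h⟩ := hZ z hz
        refine ⟨hzI, ?_⟩
        simp only [List.map_cons, List.map_nil, List.sum_cons, List.sum_nil, add_zero, zpow_zero, mul_one,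
          one_mul] at h ⊢
        rw [hLz z hzI.1] at h
        linarith)
      (by
        obtain ⟨x₀, hx₀I, hx₀⟩ := hwit
        refine ⟨x₀, hx₀I, ?_⟩
        simp only [List.map_cons, List.map_nil, List.sum_cons, List.sum_nil, add_zero, zpow_zero, mul_one,
          one_mul] at hx₀ ⊢
        rw [hLz x₀ hx₀I.1] at hx₀
        intro h; apply hx₀; linarith)
    rw [hA0, signVar_zero_cons]
    refine hih.trans (le_of_eq (signVar_congr (List.Forall₂.cons ?_ ?_)))
    · simp only [List.map_cons, List.map_nil, List.sum_cons, List.sum_nil, add_zero, zpow_zero, mul_one, one_mul]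
      exact signRel_of_posMul (zpow_pos hc0 k) (mul_comm _ _)
    · exact List.forall₂_same.mpr (fun u _ => ⟨Iff.rfl, Iff.rfl⟩)
  · -- `A ≠ 0`: put `(g/σL) x^k` into the low data
    have hσL : σL ≠ 0 := fun h => hA0 (by rw [hA, h, zero_mul])
    have hflagL : ∃ t ∈ L, 0 < t.1 := by
      by_contra hno; exact hA0 (by rw [hA, hELzero hno, mul_zero])
    have hELc := hELpos hflagL _ hc.1
    have hσg : 0 ≤ σL * g := by
      rw [hA] at hAg'
      by_contra hneg; push Not at hneg
      have : σL * (L.map (fun t : ℝ × ℤ × ℤ => t.1 * (((a + b) / 2) ^ t.2.1 * ((a + b) / 2 - a) ^ t.2.2))).sum * g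
          = (σL * g) * (L.map (fun t : ℝ × ℤ × ℤ =>
              t.1 * (((a + b) / 2) ^ t.2.1 * ((a + b) / 2 - a) ^ t.2.2))).sum := by ring
      rw [this] at hAg'
      have := mul_neg_of_neg_of_pos hneg hELc
      linarith
    have hcoef : 0 ≤ g / σL := by
      rcases lt_or_gt_of_ne hσL with hs | hs
      · exact div_nonneg_of_nonpos (by nlinarith) hs.le
      · exact div_nonneg (by nlinarith) hs.le
    have hadm : ∀ t ∈ (g / σL, k, (0 : ℤ)) :: L, 0 ≤ t.1 ∧ t.2.1 + t.2.2 ≤ k ∧ t.2.2 ≤ 0 := by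
      intro t ht
      rcases List.mem_cons.mp ht with rfl | ht
      · exact ⟨hcoef, by simp, le_rfl⟩
      · obtain ⟨h1, h2, h3⟩ := hL t ht
        exact ⟨h1, by omega, h3⟩
    have hexp : ∀ y, a < y → σL * (((g / σL, k, (0 : ℤ)) :: L).map (fun t : ℝ × ℤ × ℤ =>
        t.1 * (y ^ t.2.1 * (y - a) ^ t.2.2))).sum
        = g * y ^ k + σL * (L.map (fun t : ℝ × ℤ × ℤ => t.1 * (y ^ t.2.1 * (y - a) ^ t.2.2))).sum := by
      intro y hy
      simp only [List.map_cons, List.sum_cons, zpow_zero, mul_one]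
      rw [mul_add, ← mul_assoc, mul_div_cancel₀ _ hσL]
    have hih := ih k N σL σH ((g / σL, k, (0 : ℤ)) :: L) H (q :: W₁) hW₀len hk1N hadm hH hW₀pw hWbd' Z
      (by
        intro z hz
        obtain ⟨hzI, h⟩ := hZ z hz
        refine ⟨hzI, ?_⟩
        rw [hexp z hzI.1]
        simp only [List.map_cons, List.sum_cons] at h ⊢
        linarith)
      (by
        obtain ⟨x₀, hx₀I, hx₀⟩ := hwit
        refine ⟨x₀, hx₀I, ?_⟩
        rw [hexp x₀ hx₀I.1]
        simp only [List.map_cons, List.sum_cons] at hx₀ ⊢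
        intro h; apply hx₀; linarith)
    rw [hexp _ hc.1, ← hA] at hih
    by_cases hg0 : g = 0
    · rw [hg0, signVar_cons_zero_cons]
      rw [hg0, zero_mul, zero_add] at hih
      exact hih
    · have hAgpos : 0 < A * g := lt_of_le_of_ne hAg' (Ne.symm (mul_ne_zero hA0 hg0))
      rw [signVar_cons_cons_of_ne_zero hA0 hg0, if_neg hAg, zero_add]
      refine hih.trans (le_of_eq (signVar_congr (List.Forall₂.cons ?_ ?_)))
      · -- `g c^k + A` has the sign of `g`
        have hck : 0 < ((a + b) / 2) ^ k := zpow_pos hc0 k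
        rcases lt_or_gt_of_ne hg0 with hs | hs
        · have hAn : A < 0 := by nlinarith
          have : g * ((a + b) / 2) ^ k < 0 := mul_neg_of_neg_of_pos hs hck
          constructor
          · constructor <;> intro <;> linarith
          · constructor <;> intro <;> linarith
        · have hAp : 0 < A := by nlinarith
          have : 0 < g * ((a + b) / 2) ^ k := mul_pos hs hck
          constructor
          · constructor <;> intro <;> linarith
          · constructor <;> intro <;> linarith
      · exact List.forall₂_same.mpr (fun u _ => ⟨Iff.rfl, Iff.rfl⟩)

/-- **TWO-SIDED DESCARTES–LAGUERRE RULE ON `(a,b)` (abstract form)** — statement and proof plan in the module docstring: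
`#zeros of F in (a,b) ≤ Var(σ_L·L(c), g_1, …, g_r, σ_H·H(c))` (admissible tails, window exponents increasing in `(e, N)`). [folklore] -/
theorem card_le_signVar_window (a b : ℝ) (ha : 0 < a) (hab : a < b) :
    ∀ (r : ℕ) (e N : ℤ) (σL σH : ℝ) (L H : List (ℝ × ℤ × ℤ)) (W : List (ℤ × ℝ)),
    W.length = r → e + 1 < N →
    (∀ t ∈ L, 0 ≤ t.1 ∧ t.2.1 + t.2.2 ≤ e ∧ t.2.2 ≤ 0) →
    (∀ t ∈ H, 0 ≤ t.1 ∧ N ≤ t.2.1 ∧ t.2.2 ≤ 0) →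
    W.Pairwise (fun p q => p.1 < q.1) → (∀ p ∈ W, e < p.1 ∧ p.1 < N) →
    ∀ Z : Finset ℝ,
    (∀ z ∈ Z, z ∈ Ioo a b ∧
      σL * (L.map (fun t : ℝ × ℤ × ℤ => t.1 * (z ^ t.2.1 * (z - a) ^ t.2.2))).sum
        + (W.map (fun p : ℤ × ℝ => p.2 * z ^ p.1)).sum
        + σH * (H.map (fun t : ℝ × ℤ × ℤ => t.1 * (z ^ t.2.1 * (b - z) ^ t.2.2))).sum = 0) →
    (∃ x ∈ Ioo a b,
      σL * (L.map (fun t : ℝ × ℤ × ℤ => t.1 * (x ^ t.2.1 * (x - a) ^ t.2.2))).sum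
        + (W.map (fun p : ℤ × ℝ => p.2 * x ^ p.1)).sum
        + σH * (H.map (fun t : ℝ × ℤ × ℤ => t.1 * (x ^ t.2.1 * (b - x) ^ t.2.2))).sum ≠ 0) →
    Z.card ≤ signVar (σL * (L.map (fun t : ℝ × ℤ × ℤ =>
        t.1 * (((a + b) / 2) ^ t.2.1 * ((a + b) / 2 - a) ^ t.2.2))).sum
      :: (W.map Prod.snd ++ [σH * (H.map (fun t : ℝ × ℤ × ℤ =>
        t.1 * (((a + b) / 2) ^ t.2.1 * (b - (a + b) / 2) ^ t.2.2))).sum])) := by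
  intro r
  induction r with
  | zero =>
    intro e N σL σH L H W hWlen heN hL hH _ _ Z hZ hwit
    have hW : W = [] := List.eq_nil_of_length_eq_zero hWlen
    subst hW
    exact card_le_signVar_window_base a b ha hab e N σL σH L H heN hL hH Z hZ hwit
  | succ r ih =>
    intro e N σL σH L H W hWlen heN hL hH hWpw hWbd Z hZ hwit
    obtain ⟨p, W₀, rfl⟩ : ∃ p W₀, W = p :: W₀ := by
      cases W with
      | nil => simp at hWlen
      | cons p W₀ => exact ⟨p, W₀, rfl⟩
    obtain ⟨k, g⟩ := p
    have hW₀len : W₀.length = r := by simpa using hWlen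
    have hkb : e < k ∧ k < N := hWbd (k, g) (by simp)
    rw [List.pairwise_cons] at hWpw
    obtain ⟨hkW₀, hW₀pw⟩ := hWpw
    have hW₀bd : ∀ q ∈ W₀, e < q.1 ∧ q.1 < N := fun q hq => hWbd q (List.mem_cons_of_mem _ hq)
    simp only [List.map_cons, List.cons_append]
    by_cases hAg : σL * (L.map (fun t : ℝ × ℤ × ℤ =>
        t.1 * (((a + b) / 2) ^ t.2.1 * ((a + b) / 2 - a) ^ t.2.2))).sum * g < 0
    · exact card_le_signVar_window_euler a b ha hab e N σL σH L H k g W₀ heN hL hH hkb hkW₀ hW₀pw hW₀bd Z hZ hwit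
        (fun e' N' σL' σH' L' H' W' hW' => ih e' N' σL' σH' L' H' W' (hW'.trans hW₀len)) hAg
    · cases W₀ with
      | cons q W₁ =>
        exact card_le_signVar_window_absorb q W₁ a b ha hab e N σL σH L H k g heN hL hH hkb hkW₀ hW₀pw hW₀bd Z hZ hwit
          (fun e' N' σL' σH' L' H' W' hW' => ih e' N' σL' σH' L' H' W' (hW'.trans hW₀len)) hAg
      | nil =>
        exact card_le_signVar_window_single a b ha hab e N σL σH L H k g heN hL hH hkb hkW₀ hW₀pw hW₀bd Z hZ hwit hAg

end Summit.ValiantsHypothesis.ValiantsHypothesis.Theorems.KPlusLogSqLaw.LocalDescartes
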